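import Literature.MathematicalPhysics.QuantumFieldTheory.Balaban1983to89.FlowStepRuns

/-!
# `Balaban1983to89.B16SmallCouplings` (v1.1) — runs with small bare coupling from the PRINTED upper β-bound alone; the
reader's hypothesis pair (`LogNormalised`, `SmallCouplingsOccur`) of `B16B10Shape` is MIS-CUT AT K = 0 (kernel
vacuity certificate) and REPAIRED (K-indexed forms, one of the two discharged)

CITATION HEADER (lean-in-tree rule 2026-08-18).  Sources:
(B12 = [I]) T. Bałaban, *Renormalization group approach to lattice gauge field theories. I. Generation of effective
actions in a small field approximation and a coupling constant renormalization in four dimensions*, Commun. Math.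
Phys. **109**, 249–301 (1987), doi:10.1007/bf01215223, bib `Balaban1987RG1` (held:
`paper:balaban1987-cmp109-rg-i-small-field`; journal page = PDF page + 248);
(B14 = [III]) T. Bałaban, *Convergent renormalization expansions for lattice gauge theories*, Commun. Math. Phys.
**119**, 243–285 (1988), doi:10.1007/bf01217741, bib `Balaban1988Convergent` (journal page = PDF page + 242);
(B16) T. Bałaban, *Large field renormalization. II. Localization, exponentiation, and bounds for the R operation*,
Commun. Math. Phys. **122**, 355–392 (1989), doi:10.1007/bf01238433, bib `Balaban1989LargeFieldII`.  The quotations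
below were READ AS IMAGES on the x2 page renders of the cell (`run/shared/lean/pub/pub-balaban/b2b-balaban-ref1/pages/`:
`1987-cmp109-rg-I-small-field-p004-x2.png`, `…-p008-x2.png`, `…-p016-x2.png` = [I] pp. 252, 256, 264;
`1988-cmp119-convergent-renormalization-p020-x2.png` = [III] p. 262), not on an OCR layer:

* [I] p. 256 [8], after (0.20): *"We continue the calculation of the effective actions until we reach the unit
  lattice, or rather until we reach a scale which we define as the unit scale. Let us denote the corresponding index
  by K, hence ε = L^{−K}, and the sequence of actions and coupling constants is defined for k = 0, 1, ..., K."*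
  and (0.23), same page [8]: *"Thus we obtain after k steps  E_k(U_k) = Σ_{j=1}^{k} [−β_j(g_{j−1})A^η(U_k) + E^{(j)}(U_k)].
  (0.23)"* — k terms after k steps, so the vacuum-energy sum is EMPTY at k = 0 (second locator for §2 (b); XREAD of v1
  by the B16 owner lineage `b2b-balaban-b02-g9`, cell GAPS C-b02g9-4, remark R1).
* [I] p. 264 [16], on the β-functions β_{j+1}(g_j) of (1.22): *"It is a smooth function defined on the interval [0, γ],
  (or analytic), uniformly bounded on this interval together with all derivatives. We will investigate other
  properties in a separate paper."* — the cell's `FlowStep.BetaUpperH β′ γ β` (uniform UPPER bound on the boxes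
  `]0, γ]^{k+1}`; the printed β_{j+1}(g_j) is a function of the single variable g_j, the history family `FlowStep.HBeta`
  is the cell's generalisation of which print is the special case — XREAD C-b02g9-4 R2; only the UPPER half of
  "uniformly bounded" is used — R3) is the only property of the β-functions used in this file; and Theorem 3,
  same page: *"… if κ ≥ κ₀, M ≥ M(κ), 0 < g_k ≤ γ for k = 0, 1, …, K, then the sequence of actions A_k, defined
  inductively by the small field renormalization transformations (0.17)–(0.20), satisfy all the inductive assumptions
  …"* (`Setup.Flow.InInterval`).
* [I] p. 252 [4], (0.2): *"A^ε(U) = Σ_{p∈T_ε} ε^{d−4}[1 − Re tr U(∂p)], where tr is the normalized trace, i.e. tr 1 = 1."*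
  (so `A ≥ 0` on unitary configurations).
* [III] p. 262 [20]: *"The constant E_k (depending on {Ω_j}, {Λ_j} also) is obtained by subtracting one-step vacuum
  energy expressions, generated in small field regions, from the initial constant E. This initial constant is defined
  in fact as a sum of all such expressions for all the lattices T^{(k)} as the small field regions."* and Theorem 1,
  same page: *"… the sequence of densities {ρ_k}, generated by successive applications of the operations 𝐑𝐓 to the
  density ρ₀ = exp[−(1/g₀²)A − E], satisfies all the inductive assumptions."*
* B16 (0.1) pp. 355–356 with *"the constants E_−, E_+ independent of k, T_η, U_k"* — typed in the sibling `B16` as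
  `B16.UV01With` / `B16.UVBound01` (constant-exponent reading) and used here BY NAME only.

WHAT THIS MODULE DOES (audit cell `pub-balaban`, unit `b2b-balaban-pv24-g4` = SURGE NODE PROVER #24 gen 4, owner
lineage of `B16B10Shape` / `B16ZLower` / `B16TstarCount`; journal row SMALLCOUPLINGS-KERNEL; value = a KERNEL
CERTIFICATE + a located TYPING CORRECTION of a reader's hypothesis, NOT summit progress; nothing of the series is
asserted; v1 p181694 cross-read by the B16 owner lineage `b2b-balaban-b02-g9` — cell GAPS C-b02g9-4: misquotations 0,
violations 0, objections 0, remarks R1–R3 folded into this header; v1.1 = that DOCFIX + the APPEND-ONLY §5).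
The sibling `B16B10Shape` (§3) proves `not_uvBound01_of_smallCouplings`: the constant-exponent reading
`B16.UVBound01 C` fails under TWO READER'S HYPOTHESES — `LogNormalised C γ c C₀` (the step-0 logarithm
`UnitConfigLog`, uniform over the ]0, γ]-family) and `SmallCouplingsOccur C γ` (arbitrarily small bare couplings occur
in the family) — and `DagBinding.not_forall_uvStability4D_leaves_of_smallCouplings` carries the pair to the carver's
`World`.  Both hypotheses quantify over ALL run parameters `P = (K, m, g₀) : B12.RunParams`, including the ZERO-STEP
runs `K = 0` (no renormalization transformation at all; [I] p. 256 indexes the couplings `k = 0, 1, …, K`).  Here: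

* §1 — FORWARD ITERATION UNDER THE UPPER β-BOUND ALONE (pure real analysis on sequences, then transported to
  `DagBinding.ForwardGenerated` constructions).  If a coupling sequence is generated forward by (0.20) with a history
  family `β` bounded above by `β′ ≥ 0` on the boxes `]0, γ]^{k+1}`, starts at `g_0 > 0` and has the BUDGET
  `1/γ² + β′·K ≤ 1/g_0²`, then it stays in `]0, γ]` up to `K` with `1/g_k² ≥ 1/g_0² − β′·k`
  (`forward_inInterval_of_betaUpper`; induction on the prefix — no continuity, no lower bound or sign of β, no
  intermediate-value argument, in contrast with the endpoint theorems of `FlowStep` / `FlowStepRuns` §9, which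
  prescribe `g_K` and need the two-sided bound).  Hence for every `K`, `m`, `δ > 0` there is a bare coupling
  `0 < g₀ < δ` whose run stays in `]0, γ]` (`small_bare_run_exists`): fine lattices with small bare coupling are in
  the ]0, γ]-family as soon as the β-functions are bounded above — the printed property (p. 264).
* §2 — VACUITY CERTIFICATE FOR THE PAIR AS TYPED.  (a) `SmallCouplingsOccur C γ` is witnessed by ZERO-STEP runs
  `P = (0, m, g₀)` from the clause `g_0 = g₀` of forward generation ([I] (0.17)) and non-empty lattices alone
  (`smallCouplingsOccur_of_zeroStep`) — it never exercises the flow.  (b) `LogNormalised C γ c C₀` (c > 0) is FALSE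
  for every γ > 0 as soon as the zero-step runs of `C` have step-0 densities `ρ₀ ≤ 1` — which is the printed
  normalisation read at K = 0: ρ₀ = exp[−(1/g₀²)A − E] ([III] Thm 1) with A ≥ 0 ((0.2) [I]) and E = the sum of the
  one-step expressions over the K scales ([III] p. 262, [I] (0.23) p. 256; the cell's leaf
  `B16B10Shape.CountertermData.ESum`), empty for K = 0 — together with `g_0 = g₀` and non-empty lattices
  (`not_logNormalised_of_zeroStep`): a zero-step run with
  `g₀ < e^{−C₀/c}` in ]0, γ] violates `UnitConfigLog`.  So on such constructions the hypothesis `hnorm` of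
  `B16B10Shape.not_uvBound01_of_smallCouplings` (and of the `DagBinding` twin) is UNSATISFIABLE
  (`logNormalised_family_unsatisfiable`): the v1 theorem is correct but carries no content there.  The defect is a
  CUT AT K = 0: the reader's leaves give `UnitConfigLog` only for runs with at least one step
  (`B16B10Shape.unitConfigLog_of_leaves`, hypothesis `1 ≤ S.K`).
* §3 — THE REPAIR.  `LogNormalisedFrom C γ c C₀ K₀` / `SmallCouplingsOccurFrom C γ K₀` restrict both hypotheses to
  runs with `K ≥ K₀` (`K₀ = 0` ↔ the originals; monotone in `K₀`; `SmallCouplingsOccurFrom` monotone in γ); the §3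
  bookkeeping of `B16B10Shape` goes through verbatim (`not_uv01With_of_smallCouplingsFrom`,
  `not_uvBound01_of_smallCouplingsFrom`); and `SmallCouplingsOccurFrom C γ K₀` is DISCHARGED for every `K₀` and every
  `γ > 0` from forward generation + the printed upper β-bound on some box family `]0, γ₀]^{k+1}` + non-empty lattices
  (`smallCouplingsOccurFrom_of_betaUpper`, by §1).  HEADLINE `not_uvBound01_of_betaUpper`: for a forward-generated
  construction with β bounded above and non-empty lattices, the constant-exponent reading (B) fails as soon as, for
  each γ > 0, the step-0 logarithm holds with SOME c > 0, C₀ and from SOME run length K₀ on — ONE reader's hypothesis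
  instead of two, and a satisfiable one (§4).  `not_forall_uvStability4D_leaves_of_betaUpper` is the `World` twin,
  sharper than `DagBinding`'s (the logarithm is needed at the world's own γ only).
* §4 — NON-VACUITY OF THE REPAIRED HYPOTHESES.  A toy `B16.Construction` (`toyModel β c C₀`: couplings generated by
  (0.20) from the bare coupling as in `FlowStepRuns.modelOf`, one lattice site, densities `ρ_k ≡ 1` on zero-step
  runs and `ρ_k ≡ exp(c·log g₀⁻¹ − C₀)` on runs with K ≥ 1) satisfies SIMULTANEOUSLY forward generation, non-empty lattices, the
  sub-unit zero-step densities of §2 and `LogNormalisedFrom … 1` at every γ (`toyModel_hypotheses`); with the zero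
  β-family (bounded above by 0) every hypothesis of the headline holds (`toyModel_headline_hypotheses`), while
  `LogNormalised` fails there (§2).  So the repaired theorem has content exactly where v1 had none.

* §5 (v1.1, APPEND-ONLY — no v1 declaration touched) — SHARPENINGS.  (a) ONE γ SUFFICES: `LogNormalisedFrom` and
  `B16.UV01With` are antitone in γ, so the step-0 logarithm at a SINGLE γ₁ > 0 (with `c > 0`, from some `K₀` on) already
  excludes `B16.UVBound01` for a forward-generated construction with β bounded above and non-empty lattices
  (`not_uvBound01_of_betaUpper_at`; v1's headline asked it at every γ > 0).  (b) THE K₀ = 1 LOGARITHM FROM THE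
  LOCATED LEAVES: a family of the per-run carriers of `B16B10Shape` §4 (`CountertermData`: (1.15) one-step constants,
  E = their sum, blocking, the reader's items `TstarCount` / `ZLower` / `EflBound`, ρ₀ ≥ e^{−E} somewhere, couplings
  dictionary) with constants `L ≥ 2`, `d(𝔤)`, `log σ₀`, `C_z`, `C_E` uniform in the run GIVES
  `LogNormalisedFrom C γ (3(1 − L⁻⁴)d(𝔤)) (4|log σ₀| + C_z + C_E/(L⁴ − 1)) 1` for γ ≤ 1
  (`logNormalisedFrom_one_of_leaves`, by `B16B10Shape.unitConfigLog_of_leaves` run by run — the cut `1 ≤ K` is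
  exactly its hypothesis `hK`).  (c) Hence `not_uvBound01_of_leaves`: the constant-exponent reading (B) FAILS for every
  forward-generated `B16.Construction` with β bounded above, non-empty lattices, `d(𝔤) ≥ 1`, and such a leaf family on
  the runs of ONE ]0, γ₁]-family (γ₁ ≤ 1) with at least one step — every input a located leaf, a labelled reader's item
  or a modelling clause of the cell; no free-standing normalisation hypothesis remains.

SCOPE, stated honestly.  Nothing here decides whether Bałaban's constructions satisfy the step-0 logarithm for K ≥ 1
(that is `B16B10Shape` §4: located leaves + the reader's items `ZLower` — PROVED for U(N), SU(N) in `B16ZLower` —,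
`TstarCount` — PROVED in `B16TstarCount` —, and `EflBound`, author question (ii) of cell GAPS G-pv24-1, OPEN); this
file removes the OTHER hypothesis of the pair and the K = 0 artefact.  The sub-unit zero-step density of §2 (b) is an
explicit hypothesis (`hρ`), located as above, never asserted of any construction.  The upper β-bound is the printed
p. 264 sentence (proof deferred in print to §5 / (5.10), (5.42): `FlowStepRuns` §5 derives `BetaUpperH` from the
cell's typed (5.10)); forward generation and non-empty lattices are the cell's modelling clauses
(`DagBinding.ForwardGenerated`, [I] (0.17)–(0.20); `|T_1^{(0)}| > 0`, [I] (0.1) p. 251).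

ABSOLUTE RULE.  No internally-minted statement enters as a cited fact: every `theorem` below is kernel-proved from
Mathlib and the sibling modules' DEFINITIONS; the two new `def … : Prop` are K-indexed forms of the sibling's reader's
hypotheses (hypotheses, never facts); the toy construction of §4 is a model, not a claim about the series; the papers'
disputed steps are not used.  Imports `FlowStepRuns` (hence `FlowStep`, `DagBinding`, `B16B10Shape`, `B16`, `B12`);
restates nothing of them.  Mathlib only otherwise; no `sorry` / `axiom`.  Companion: GAPS row C-pv24g4-1, journal
CLAIMS.log `SMALLCOUPLINGS-KERNEL`, HANDOFF.md § b2b-balaban-pv24 gen 4.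
-/

namespace Literature.MathematicalPhysics.QuantumFieldTheory.Balaban1983to89

namespace B16SmallCouplings

open FlowStep (HBeta prefixOf prefixOf_apply Box mem_box BetaUpperH box_mono)
open DagBinding (ForwardGenerated World leaves uvStability4D_leaves_iff)
open B16B10Shape (UnitConfigLog LogNormalised SmallCouplingsOccur g0_floor_of_uvIneq_zero CountertermData
  unitConfigLog_of_leaves)
open FlowStepRuns (solveCoupling solveCoupling_pos inv_sq_solveCoupling genSeq genSeq_zero genSeq_succ genFlow)

/-! ## §1. Forward iteration under the upper β-bound alone -/

/-- From a lower bound `1/γ² ≤ 1/x²` with `x, γ > 0` conclude `x ≤ γ`. Real arithmetic. [folklore] -/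
theorem le_of_inv_sq_le {γ x : ℝ} (hγ : 0 < γ) (hx : 0 < x) (h : 1 / γ ^ 2 ≤ 1 / x ^ 2) : x ≤ γ :=
  (pow_le_pow_iff_left₀ hx.le hγ.le two_ne_zero).mp ((one_div_le_one_div (pow_pos hγ 2) (pow_pos hx 2)).mp h)

/-- **Forward iteration under the UPPER β-bound alone.**  A coupling sequence `g` generated forward by (0.20) with the
history family `β` (clause `hstep`, verbatim the generation clause of `DagBinding.ForwardGenerated` /
`FlowStep.B12Thm2Shape_of_betaBoundsH`), with `β ≤ β′` on the boxes `]0, γ]^{k+1}` (`β′ ≥ 0`), `g_0 > 0` and the budget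
`1/γ² + β′K ≤ 1/g_0²`, stays in `]0, γ]` for `k ≤ K` and obeys `1/g_k² ≥ 1/g_0² − β′k` there.  Induction on the
prefix: at each step the right side of (0.20) is `≥ 1/g_k² − β′ ≥ 1/g_0² − β′(k+1) ≥ 1/γ² > 0`, so the generation
clause applies and gives the next coupling in `]0, γ]`.  Uses only the printed upper bound (p. 264) — no continuity, no
sign or lower bound of β. [cite: Balaban1987RG1, §1 p.264 and (0.20) p.256] -/
theorem forward_inInterval_of_betaUpper (β : HBeta) {γ β' : ℝ} (hγ : 0 < γ) (hβ' : 0 ≤ β')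
    (hup : BetaUpperH β' γ β) (g : ℕ → ℝ) (K : ℕ)
    (hstep : ∀ k, k < K → (∀ i, i ≤ k → 0 < g i) → 0 < 1 / (g k) ^ 2 - β k (prefixOf g k) →
      0 < g (k + 1) ∧ 1 / (g (k + 1)) ^ 2 = 1 / (g k) ^ 2 - β k (prefixOf g k))
    (h0 : 0 < g 0) (hbudget : 1 / γ ^ 2 + β' * K ≤ 1 / (g 0) ^ 2) :
    ∀ k, k ≤ K → 0 < g k ∧ g k ≤ γ ∧ 1 / (g 0) ^ 2 - β' * k ≤ 1 / (g k) ^ 2 := by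
  have hKβ : 0 ≤ β' * (K : ℝ) := mul_nonneg hβ' (Nat.cast_nonneg K)
  -- strong form over prefixes (the history dependence of β needs the whole prefix in the box)
  have main : ∀ k, k ≤ K → ∀ i, i ≤ k →
      0 < g i ∧ g i ≤ γ ∧ 1 / (g 0) ^ 2 - β' * i ≤ 1 / (g i) ^ 2 := by
    intro k
    induction k with
    | zero =>
      intro _ i hi
      obtain rfl := Nat.le_zero.mp hi
      exact ⟨h0, le_of_inv_sq_le hγ h0 (by linarith), by simp⟩
    | succ k ih =>
      intro hk i hi
      have hkK : k < K := Nat.lt_of_succ_le hk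
      have hprev := ih hkK.le
      rcases Nat.lt_or_eq_of_le hi with hlt | rfl
      · exact hprev i (Nat.lt_succ_iff.mp hlt)
      · have hposAll : ∀ i, i ≤ k → 0 < g i := fun i hi => (hprev i hi).1
        have hbox : prefixOf g k ∈ Box γ k :=
          mem_box.mpr fun j =>
            ⟨(hprev j (Nat.lt_succ_iff.mp j.isLt)).1, (hprev j (Nat.lt_succ_iff.mp j.isLt)).2.1⟩
        have hβk : β k (prefixOf g k) ≤ β' := hup k _ hbox
        have hk3 : 1 / (g 0) ^ 2 - β' * (k : ℝ) ≤ 1 / (g k) ^ 2 := (hprev k le_rfl).2.2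
        have hk1K : (k : ℝ) + 1 ≤ (K : ℝ) := by exact_mod_cast hk
        have hmul : β' * ((k : ℝ) + 1) ≤ β' * (K : ℝ) := mul_le_mul_of_nonneg_left hk1K hβ'
        have hdist : β' * ((k : ℝ) + 1) = β' * (k : ℝ) + β' := by ring
        have hrhs_lb : 1 / (g 0) ^ 2 - β' * ((k : ℝ) + 1) ≤ 1 / (g k) ^ 2 - β k (prefixOf g k) := by
          linarith
        have hrhs_pos : 0 < 1 / (g k) ^ 2 - β k (prefixOf g k) := by
          have : 0 < 1 / γ ^ 2 := by positivity
          linarith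
        obtain ⟨hpos1, heq1⟩ := hstep k hkK hposAll hrhs_pos
        refine ⟨hpos1, le_of_inv_sq_le hγ hpos1 ?_, ?_⟩
        · rw [heq1]; linarith
        · push_cast
          rw [heq1]; linarith
  exact fun k hk => main k hk k le_rfl

/-- The budget solved for the bare coupling: `0 < g₀ ≤ A^{−1/2}` (`FlowStepRuns.solveCoupling A`) gives `A ≤ 1/g₀²`. [folklore] -/
theorem budget_of_le_solveCoupling {A g0 : ℝ} (hA : 0 < A) (hg0 : 0 < g0) (hle : g0 ≤ solveCoupling A) :
    A ≤ 1 / g0 ^ 2 := by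
  have hsq : g0 ^ 2 ≤ (solveCoupling A) ^ 2 := pow_le_pow_left₀ hg0.le hle 2
  have h := one_div_le_one_div_of_le (pow_pos hg0 2) hsq
  rwa [inv_sq_solveCoupling hA] at h

/-- For every `γ > 0`, `β′ ≥ 0`, `K` and `δ > 0` there is a bare coupling `0 < g₀ < δ` with the budget
`1/γ² + β′K ≤ 1/g₀²` (take `g₀ = min(δ/2, (1/γ² + β′K)^{−1/2})`). Real arithmetic. [folklore] -/
theorem small_bare_coupling_exists {γ β' δ : ℝ} (hγ : 0 < γ) (hβ' : 0 ≤ β') (hδ : 0 < δ) (K : ℕ) :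
    ∃ g0 : ℝ, 0 < g0 ∧ g0 < δ ∧ 1 / γ ^ 2 + β' * K ≤ 1 / g0 ^ 2 := by
  have hA : 0 < 1 / γ ^ 2 + β' * K := by
    have : 0 < 1 / γ ^ 2 := by positivity
    have : 0 ≤ β' * (K : ℝ) := mul_nonneg hβ' (Nat.cast_nonneg K)
    linarith
  have hpos : 0 < min (δ / 2) (solveCoupling (1 / γ ^ 2 + β' * K)) :=
    lt_min (by linarith) (solveCoupling_pos hA)
  exact ⟨min (δ / 2) (solveCoupling (1 / γ ^ 2 + β' * K)), hpos,
    lt_of_le_of_lt (min_le_left _ _) (by linarith), budget_of_le_solveCoupling hA hpos (min_le_right _ _)⟩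

/-- §1 at the construction level: a `DagBinding.ForwardGenerated` construction whose history β-family is bounded above
by `β′ ≥ 0` on the boxes `]0, γ]^{k+1}` keeps every run with bare coupling `g₀ > 0` and budget `1/γ² + β′K ≤ 1/g₀²`
inside `]0, γ]` (`Setup.Flow.InInterval`), with `1/g_k² ≥ 1/g₀² − β′k`. [cite: Balaban1987RG1, §1 p.264 and (0.17)–(0.20) pp.255–256] -/
theorem inInterval_of_betaUpper {C : B12.Construction} {β : HBeta} (hgen : ForwardGenerated C β) {γ β' : ℝ}
    (hγ : 0 < γ) (hβ' : 0 ≤ β') (hup : BetaUpperH β' γ β) (P : B12.RunParams) (hg0 : 0 < P.g0)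
    (hbudget : 1 / γ ^ 2 + β' * P.K ≤ 1 / P.g0 ^ 2) :
    (C P).flow.InInterval γ P.K ∧
      ∀ k, k ≤ P.K → 1 / P.g0 ^ 2 - β' * k ≤ 1 / ((C P).flow.g k) ^ 2 := by
  have h0 : (C P).flow.g 0 = P.g0 := hgen.1 P
  have h := forward_inInterval_of_betaUpper β hγ hβ' hup (C P).flow.g P.K (fun k hk => hgen.2 P k hk)
    (by rw [h0]; exact hg0) (by rw [h0]; exact hbudget)
  refine ⟨fun k hk => ⟨(h k hk).1, (h k hk).2.1⟩, fun k hk => ?_⟩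
  have := (h k hk).2.2
  rwa [h0] at this

/-- **Runs of every length with arbitrarily small bare coupling lie in the ]0, γ]-family**: for a forward-generated
construction with β bounded above by `β′ ≥ 0` on the boxes `]0, γ]^{k+1}`, every `K`, `m` and `δ > 0` admit a bare
coupling `0 < g₀ < δ` whose run `(K, m, g₀)` satisfies the standing hypothesis `0 < g_k ≤ γ, k = 0, …, K` of [I]
Thm 3 / B16 Thm 1. [cite: Balaban1987RG1, Thm 3 p.264] -/
theorem small_bare_run_exists {C : B12.Construction} {β : HBeta} (hgen : ForwardGenerated C β) {γ β' : ℝ}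
    (hγ : 0 < γ) (hβ' : 0 ≤ β') (hup : BetaUpperH β' γ β) (K m : ℕ) {δ : ℝ} (hδ : 0 < δ) :
    ∃ g0 : ℝ, 0 < g0 ∧ g0 < δ ∧ (C ⟨K, m, g0⟩).flow.InInterval γ K ∧ (C ⟨K, m, g0⟩).flow.g 0 = g0 := by
  obtain ⟨g0, hg0, hg0δ, hb⟩ := small_bare_coupling_exists hγ hβ' hδ K
  exact ⟨g0, hg0, hg0δ, (inInterval_of_betaUpper hgen hγ hβ' hup ⟨K, m, g0⟩ hg0 hb).1, hgen.1 _⟩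

/-! ## §2. Vacuity certificate for the pair (`LogNormalised`, `SmallCouplingsOccur`) AS TYPED: the cut at K = 0 -/

/-- (a) `SmallCouplingsOccur C γ` AS TYPED is witnessed by ZERO-STEP runs: if every run starts at its bare coupling
(`g_0 = g₀`, the first clause of `DagBinding.ForwardGenerated`; [I] (0.17)) and the lattices are non-empty, then for
every `δ > 0` the run `(K, m, g₀) = (0, 0, min(δ/2, γ))` is in the ]0, γ]-family with `g_0 < δ` — the flow is never
exercised. [folklore] -/
theorem smallCouplingsOccur_of_zeroStep (C : B16.Construction) {γ : ℝ} (hγ : 0 < γ)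
    (h0 : ∀ P : B12.RunParams, (C P).flow.g 0 = P.g0)
    (hN : ∀ P : B12.RunParams, 0 < ((C P).numSites 0 : ℝ)) : SmallCouplingsOccur C γ := by
  intro δ hδ
  refine ⟨⟨0, 0, min (δ / 2) γ⟩, ?_, hN _, ?_⟩
  · intro k hk
    obtain rfl := Nat.le_zero.mp hk
    rw [h0]
    exact ⟨lt_min (by linarith) hγ, min_le_right _ _⟩
  · rw [h0]
    exact lt_of_le_of_lt (min_le_left _ _) (by linarith)

/-- (a′) In particular for every forward-generated `B16.Construction` with non-empty lattices, at every γ > 0. [folklore] -/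
theorem smallCouplingsOccur_of_forwardGenerated (C : B16.Construction) {β : HBeta}
    (hgen : ForwardGenerated C.toB12 β) (hN : ∀ P : B12.RunParams, 0 < ((C P).numSites 0 : ℝ))
    {γ : ℝ} (hγ : 0 < γ) : SmallCouplingsOccur C γ :=
  smallCouplingsOccur_of_zeroStep C hγ (fun P => hgen.1 P) hN

/-- (b), one run: a step-0 density bounded by 1 pointwise (`ρ₀ = exp[−(1/g₀²)A − E]` with `A ≥ 0` and `E = 0`: the
zero-step reading of [III] Thm 1 p. 262 + (0.2) [I]) on a non-empty lattice with bare coupling `0 < g_0 < e^{−C₀/c}`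
(`c > 0`) VIOLATES the step-0 logarithm `UnitConfigLog D c C₀` (which would force `ρ₀ ≥ exp((c·log g₀⁻¹ − C₀)|T|) > 1`
somewhere). Real arithmetic. [cite: Balaban1988Convergent, Thm 1 p.262] -/
theorem not_unitConfigLog_of_rho_le_one (D : B16.RunData) {c C₀ : ℝ} (hc : 0 < c)
    (hN : 0 < (D.numSites 0 : ℝ)) (hρ : ∀ V : D.Cfg 0, D.ρ 0 V ≤ 1) (hg : 0 < D.flow.g 0)
    (hsmall : D.flow.g 0 < Real.exp (-(C₀ / c))) : ¬ UnitConfigLog D c C₀ := by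
  rintro ⟨V₁, hV₁⟩
  have h1 : Real.exp ((c * Real.log (D.flow.g 0)⁻¹ - C₀) * (D.numSites 0 : ℝ)) ≤ Real.exp 0 := by
    rw [Real.exp_zero]; exact hV₁.trans (hρ V₁)
  rw [Real.exp_le_exp] at h1
  have h2 : c * Real.log (D.flow.g 0)⁻¹ - C₀ ≤ 0 :=
    le_of_mul_le_mul_right (by rw [zero_mul]; exact h1) hN
  rw [Real.log_inv] at h2
  have h3 : -Real.log (D.flow.g 0) ≤ C₀ / c := by
    rw [le_div_iff₀ hc]; linarith
  have h4 : Real.log (D.flow.g 0) < -(C₀ / c) := (Real.log_lt_iff_lt_exp hg).mpr hsmall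
  linarith

/-- (b) **`LogNormalised` AS TYPED is false** (every γ > 0, c > 0, C₀) for a construction whose runs start at the bare
coupling, whose lattices are non-empty and whose ZERO-STEP runs have step-0 densities `ρ₀ ≤ 1` (hypothesis `hρ`: the
printed normalisation ρ₀ = exp[−(1/g₀²)A − E] read at K = 0, where E — *"a sum of all such expressions for all the
lattices T^{(k)}"*, [III] p. 262; the leaf `B16B10Shape.CountertermData.ESum` — is empty and A ≥ 0 by (0.2) [I]):
witness the zero-step run with `g₀ = min(γ, e^{−C₀/c}/2)`.  The hypothesis `hρ` is stated, never asserted of any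
construction. [cite: Balaban1988Convergent, Thm 1 p.262] -/
theorem not_logNormalised_of_zeroStep (C : B16.Construction) {γ c C₀ : ℝ} (hγ : 0 < γ) (hc : 0 < c)
    (h0 : ∀ P : B12.RunParams, (C P).flow.g 0 = P.g0)
    (hN : ∀ P : B12.RunParams, 0 < ((C P).numSites 0 : ℝ))
    (hρ : ∀ (m : ℕ) (g0 : ℝ) (V : (C ⟨0, m, g0⟩).Cfg 0), (C ⟨0, m, g0⟩).ρ 0 V ≤ 1) :
    ¬ LogNormalised C γ c C₀ := by
  intro hnorm
  have hE : 0 < Real.exp (-(C₀ / c)) := Real.exp_pos _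
  have hg0pos : 0 < min γ (Real.exp (-(C₀ / c)) / 2) := lt_min hγ (by linarith)
  have hg0lt : min γ (Real.exp (-(C₀ / c)) / 2) < Real.exp (-(C₀ / c)) :=
    lt_of_le_of_lt (min_le_right _ _) (by linarith)
  have hflow : (C ⟨0, 0, min γ (Real.exp (-(C₀ / c)) / 2)⟩).flow.g 0 = min γ (Real.exp (-(C₀ / c)) / 2) := h0 _
  have hI : (C ⟨0, 0, min γ (Real.exp (-(C₀ / c)) / 2)⟩).flow.InInterval γ 0 := by
    intro k hk
    obtain rfl := Nat.le_zero.mp hk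
    rw [hflow]
    exact ⟨hg0pos, min_le_left _ _⟩
  refine not_unitConfigLog_of_rho_le_one (C ⟨0, 0, min γ (Real.exp (-(C₀ / c)) / 2)⟩) hc (hN _) (hρ 0 _)
    ?_ ?_ (hnorm _ hI)
  · rw [hflow]; exact hg0pos
  · rw [hflow]; exact hg0lt

/-- Hence the hypothesis `hnorm : ∀ γ > 0, LogNormalised C γ c (C₀ γ)` of `B16B10Shape.not_uvBound01_of_smallCouplings`
(and of `DagBinding.not_forall_uvStability4D_leaves_of_smallCouplings`) is UNSATISFIABLE on such constructions: there
the v1 theorem is vacuous.  (Its other hypothesis `hsmall` holds trivially by (a).) [folklore] -/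
theorem logNormalised_family_unsatisfiable (C : B16.Construction) {c : ℝ} (C₀ : ℝ → ℝ) (hc : 0 < c)
    (h0 : ∀ P : B12.RunParams, (C P).flow.g 0 = P.g0)
    (hN : ∀ P : B12.RunParams, 0 < ((C P).numSites 0 : ℝ))
    (hρ : ∀ (m : ℕ) (g0 : ℝ) (V : (C ⟨0, m, g0⟩).Cfg 0), (C ⟨0, m, g0⟩).ρ 0 V ≤ 1) :
    ¬ ∀ γ : ℝ, 0 < γ → LogNormalised C γ c (C₀ γ) :=
  fun h => not_logNormalised_of_zeroStep C one_pos hc h0 hN hρ (h 1 one_pos)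

/-! ## §3. The repair: K-indexed forms; `SmallCouplingsOccurFrom` discharged from the upper β-bound -/

/-- The step-0 logarithm demanded only of runs with AT LEAST `K₀` renormalization steps (K₀ = 1: the runs for which
`B16B10Shape.unitConfigLog_of_leaves` derives it from the located leaves, hypothesis `1 ≤ S.K`).  Hypothesis, never
asserted. [cite: Balaban1988Convergent, Thm 1 p.262] -/
def LogNormalisedFrom (C : B16.Construction) (γ c C₀ : ℝ) (K₀ : ℕ) : Prop :=
  ∀ P : B12.RunParams, K₀ ≤ P.K → (C P).flow.InInterval γ P.K → UnitConfigLog (C P) c C₀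

/-- Small bare couplings occur among the runs of the ]0, γ]-family with AT LEAST `K₀` steps and a non-empty lattice
(K₀ → ∞ with g₀ → 0 is the continuum direction of (0.31) [I]).  Hypothesis as typed; DISCHARGED below
(`smallCouplingsOccurFrom_of_betaUpper`). [cite: Balaban1987RG1, (0.31) p.259] -/
def SmallCouplingsOccurFrom (C : B16.Construction) (γ : ℝ) (K₀ : ℕ) : Prop :=
  ∀ δ : ℝ, 0 < δ → ∃ P : B12.RunParams, K₀ ≤ P.K ∧ (C P).flow.InInterval γ P.K ∧
    0 < ((C P).numSites 0 : ℝ) ∧ (C P).flow.g 0 < δ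

/-- `K₀ = 0` is the sibling's `LogNormalised`. [folklore] -/
theorem logNormalisedFrom_zero_iff (C : B16.Construction) (γ c C₀ : ℝ) :
    LogNormalisedFrom C γ c C₀ 0 ↔ LogNormalised C γ c C₀ :=
  ⟨fun h P hP => h P (Nat.zero_le _) hP, fun h P _ hP => h P hP⟩

/-- `K₀ = 0` is the sibling's `SmallCouplingsOccur`. [folklore] -/
theorem smallCouplingsOccurFrom_zero_iff (C : B16.Construction) (γ : ℝ) :
    SmallCouplingsOccurFrom C γ 0 ↔ SmallCouplingsOccur C γ := by
  refine ⟨fun h δ hδ => ?_, fun h δ hδ => ?_⟩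
  · obtain ⟨P, -, hI, hN, hlt⟩ := h δ hδ
    exact ⟨P, hI, hN, hlt⟩
  · obtain ⟨P, hI, hN, hlt⟩ := h δ hδ
    exact ⟨P, Nat.zero_le _, hI, hN, hlt⟩

/-- `LogNormalisedFrom` weakens as `K₀` grows. [folklore] -/
theorem logNormalisedFrom_mono (C : B16.Construction) (γ c C₀ : ℝ) {K₀ K₁ : ℕ} (h : K₀ ≤ K₁)
    (hn : LogNormalisedFrom C γ c C₀ K₀) : LogNormalisedFrom C γ c C₀ K₁ :=
  fun P hP hI => hn P (h.trans hP) hI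

/-- In particular the sibling's `LogNormalised` gives every `LogNormalisedFrom`. [folklore] -/
theorem logNormalisedFrom_of_logNormalised (C : B16.Construction) (γ c C₀ : ℝ) (K₀ : ℕ)
    (hn : LogNormalised C γ c C₀) : LogNormalisedFrom C γ c C₀ K₀ :=
  fun P _ hI => hn P hI

/-- `SmallCouplingsOccurFrom` strengthens as `K₀` grows. [folklore] -/
theorem smallCouplingsOccurFrom_anti (C : B16.Construction) (γ : ℝ) {K₀ K₁ : ℕ} (h : K₀ ≤ K₁)
    (hs : SmallCouplingsOccurFrom C γ K₁) : SmallCouplingsOccurFrom C γ K₀ := fun δ hδ => by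
  obtain ⟨P, hK, hI, hN, hlt⟩ := hs δ hδ
  exact ⟨P, h.trans hK, hI, hN, hlt⟩

/-- `SmallCouplingsOccurFrom` is monotone in γ (`Flow.InInterval` is). [folklore] -/
theorem smallCouplingsOccurFrom_mono_gamma (C : B16.Construction) {γ γ' : ℝ} (h : γ ≤ γ') (K₀ : ℕ)
    (hs : SmallCouplingsOccurFrom C γ K₀) : SmallCouplingsOccurFrom C γ' K₀ := fun δ hδ => by
  obtain ⟨P, hK, hI, hN, hlt⟩ := hs δ hδ
  exact ⟨P, hK, fun k hk => ⟨(hI k hk).1, (hI k hk).2.trans h⟩, hN, hlt⟩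

/-- The sibling's `not_uv01With_of_smallCouplings` with both hypotheses cut at the same `K₀`: the step-0 logarithm on
the runs with `K ≥ K₀` and small bare couplings among them exclude every pair `E₋, E₊` for (0.1) at this γ (same
two-line proof: the bare-coupling floor `g₀ ≥ exp(−(E₊ + C₀)/c)` of `B16B10Shape.g0_floor_of_uvIneq_zero`). [folklore] -/
theorem not_uv01With_of_smallCouplingsFrom (C : B16.Construction) (γ c C₀ Em Ep : ℝ) (K₀ : ℕ) (hc : 0 < c)
    (hnorm : LogNormalisedFrom C γ c C₀ K₀) (hsmall : SmallCouplingsOccurFrom C γ K₀) :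
    ¬ B16.UV01With C γ Em Ep := by
  intro h
  obtain ⟨P, hK, hP, hN, hlt⟩ := hsmall (Real.exp (-((Ep + C₀) / c))) (Real.exp_pos _)
  have hfloor := g0_floor_of_uvIneq_zero (C P) c C₀ Em Ep hc (hP 0 (Nat.zero_le _)).1 hN (hnorm P hK hP)
    fun V => h P hP 0 (Nat.zero_le _) V
  exact absurd hfloor (not_le.mpr hlt)

/-- The sibling's `not_uvBound01_of_smallCouplings`, repaired: for each γ > 0 the step-0 logarithm with SOME `c > 0`,
`C₀` from SOME run length `K₀` on, and small bare couplings from that length on, exclude the constant-exponent reading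
`B16.UVBound01`. [folklore] -/
theorem not_uvBound01_of_smallCouplingsFrom (C : B16.Construction)
    (hnorm : ∀ γ : ℝ, 0 < γ → ∃ (c C₀ : ℝ) (K₀ : ℕ), 0 < c ∧ LogNormalisedFrom C γ c C₀ K₀)
    (hsmall : ∀ γ : ℝ, 0 < γ → ∀ K₀ : ℕ, SmallCouplingsOccurFrom C γ K₀) : ¬ B16.UVBound01 C := by
  rintro ⟨γ, hγ, Em, Ep, h⟩
  obtain ⟨c, C₀, K₀, hc, hn⟩ := hnorm γ hγ
  exact not_uv01With_of_smallCouplingsFrom C γ c C₀ Em Ep K₀ hc hn (hsmall γ hγ K₀) h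

/-- **`SmallCouplingsOccurFrom` DISCHARGED** (every `K₀`, every `γ > 0`) for a forward-generated `B16.Construction`
whose history β-family is bounded above by `β′ ≥ 0` on some box family `]0, γ₀]^{k+1}` (γ₀ > 0; [I] p. 264 "uniformly
bounded") and whose lattices are non-empty: by §1 the run `(K₀, 0, g₀)` with a suitable `0 < g₀ < δ` stays in
`]0, min(γ, γ₀)]`. [cite: Balaban1987RG1, §1 p.264] -/
theorem smallCouplingsOccurFrom_of_betaUpper (C : B16.Construction) {β : HBeta}
    (hgen : ForwardGenerated C.toB12 β) {γ₀ β' : ℝ} (hγ₀ : 0 < γ₀) (hβ' : 0 ≤ β')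
    (hup : BetaUpperH β' γ₀ β) (hN : ∀ P : B12.RunParams, 0 < ((C P).numSites 0 : ℝ))
    {γ : ℝ} (hγ : 0 < γ) (K₀ : ℕ) : SmallCouplingsOccurFrom C γ K₀ := by
  have key : SmallCouplingsOccurFrom C (min γ γ₀) K₀ := by
    intro δ hδ
    have hup₁ : BetaUpperH β' (min γ γ₀) β := fun k v hv => hup k v (box_mono (min_le_right _ _) k hv)
    obtain ⟨g0, -, hg0δ, hI, hflow⟩ := small_bare_run_exists hgen (lt_min hγ hγ₀) hβ' hup₁ K₀ 0 hδ
    refine ⟨⟨K₀, 0, g0⟩, le_rfl, hI, hN _, ?_⟩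
    show (C.toB12 ⟨K₀, 0, g0⟩).flow.g 0 < δ
    rw [hflow]; exact hg0δ
  exact smallCouplingsOccurFrom_mono_gamma C (min_le_left _ _) K₀ key

/-- **HEADLINE.**  For a forward-generated `B16.Construction` with β bounded above on some box family and non-empty
lattices, the constant-exponent reading (B) `B16.UVBound01 C` FAILS as soon as, for each γ > 0, the step-0 logarithm
holds with some `c > 0`, `C₀` on the runs of the ]0, γ]-family from some length `K₀` on — ONE reader's hypothesis
(`B16B10Shape` §4 derives it at K₀ = 1 from located leaves + `ZLower` (proved, `B16ZLower`) + `TstarCount` (proved,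
`B16TstarCount`) + `EflBound` (open, author question (ii) of cell GAPS G-pv24-1)) instead of v1's two.  Bookkeeping;
nothing printed asserted. [folklore] -/
theorem not_uvBound01_of_betaUpper (C : B16.Construction) {β : HBeta} (hgen : ForwardGenerated C.toB12 β)
    {γ₀ β' : ℝ} (hγ₀ : 0 < γ₀) (hβ' : 0 ≤ β') (hup : BetaUpperH β' γ₀ β)
    (hN : ∀ P : B12.RunParams, 0 < ((C P).numSites 0 : ℝ))
    (hnorm : ∀ γ : ℝ, 0 < γ → ∃ (c C₀ : ℝ) (K₀ : ℕ), 0 < c ∧ LogNormalisedFrom C γ c C₀ K₀) :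
    ¬ B16.UVBound01 C :=
  not_uvBound01_of_smallCouplingsFrom C hnorm
    fun _ hγ K₀ => smallCouplingsOccurFrom_of_betaUpper C hgen hγ₀ hβ' hup hN hγ K₀

/-- The headline in the sibling's v1 shape (`c` fixed, `C₀ = C₀(γ)`), cut at `K₀ = 1`: `hsmall` of
`B16B10Shape.not_uvBound01_of_smallCouplings` is gone, `hnorm` is asked of runs with at least one step only. [folklore] -/
theorem not_uvBound01_of_betaUpper' (C : B16.Construction) {β : HBeta} (hgen : ForwardGenerated C.toB12 β)
    {γ₀ β' : ℝ} (hγ₀ : 0 < γ₀) (hβ' : 0 ≤ β') (hup : BetaUpperH β' γ₀ β)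
    (hN : ∀ P : B12.RunParams, 0 < ((C P).numSites 0 : ℝ)) (c : ℝ) (C₀ : ℝ → ℝ) (hc : 0 < c)
    (hnorm : ∀ γ : ℝ, 0 < γ → LogNormalisedFrom C γ c (C₀ γ) 1) : ¬ B16.UVBound01 C :=
  not_uvBound01_of_betaUpper C hgen hγ₀ hβ' hup hN fun γ hγ => ⟨c, C₀ γ, 1, hc, hnorm γ hγ⟩

/-- **`World` twin**, sharper than `DagBinding.not_forall_uvStability4D_leaves_of_smallCouplings`: for a world `w` on a
forward-generated construction with `β ≤ β⁺ = w.βup` (`β⁺ ≥ 0`) on some box family and non-empty lattices, the step-0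
logarithm on the runs of the ]0, w.γ]-family from some length on ALONE makes the END hypotheses `∀ P, UVStability4D`
at the constant-exponent binding unsatisfiable — the logarithm is needed at the world's own γ only. [folklore] -/
theorem not_forall_uvStability4D_leaves_of_betaUpper (w : World) (hγ : 0 < w.γ) {c C₀ : ℝ} {K₀ : ℕ}
    (hc : 0 < c) (hnorm : LogNormalisedFrom w.C w.γ c C₀ K₀) (β : HBeta) (hgen : ForwardGenerated w.C.toB12 β)
    {γ₀ : ℝ} (hγ₀ : 0 < γ₀) (hβup : 0 ≤ w.βup) (hup : BetaUpperH w.βup γ₀ β)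
    (hN : ∀ P : B12.RunParams, 0 < ((w.C P).numSites 0 : ℝ)) :
    ¬ ∀ P, Dag.UVStability4D (leaves w P) := fun h =>
  not_uv01With_of_smallCouplingsFrom w.C w.γ c C₀ w.Em w.Ep K₀ hc hnorm
    (smallCouplingsOccurFrom_of_betaUpper w.C hgen hγ₀ hβup hup hN hγ K₀)
    fun P hP k hk V => ((uvStability4D_leaves_iff w P).1 (h P) hP).2 k hk V

/-! ## §4. Non-vacuity of the repaired hypotheses: a toy construction satisfying all of them (and §2's) at once -/

/-- TOY construction (a model of the cell's carriers, not a claim about the series): couplings generated forward by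
(0.20) from the bare coupling with the history family `β` (`FlowStepRuns.genFlow`, as in `FlowStepRuns.modelOf`); ONE
lattice site at every scale; densities `ρ_k ≡ 1` on zero-step runs and `ρ_k ≡ exp(c·log g₀⁻¹ − C₀)` on runs with
`K ≥ 1` (only `ρ₀` matters here); all other data trivial. [folklore] -/
noncomputable def toyModel (β : HBeta) (c C₀ : ℝ) : B16.Construction := fun P =>
  { flow := genFlow β P.g0
    Cfg := fun _ => Unit
    dom := fun _ => Set.univ
    effAction := fun _ _ => 0
    wilsonBG := fun _ _ => 0
    Ek := fun _ _ => 0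
    numSites := fun _ => 1
    Repr := fun _ => True
    IndAss := fun _ => True
    ρ := fun _ _ => if P.K = 0 then 1 else Real.exp (c * Real.log (P.g0)⁻¹ - C₀)
    χ := fun _ _ => 0
    Sect2Form := fun _ => True }

/-- The toy is forward-generated by (0.20) with `β` (same computation as `FlowStepRuns.modelOf_forwardGenerated`). [folklore] -/
theorem toyModel_forwardGenerated (β : HBeta) (c C₀ : ℝ) : ForwardGenerated (toyModel β c C₀).toB12 β := by
  refine ⟨fun P => genSeq_zero β P.g0, fun P k _ _ hrhs => ?_⟩
  show 0 < genSeq β P.g0 (k + 1) ∧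
    1 / (genSeq β P.g0 (k + 1)) ^ 2 = 1 / (genSeq β P.g0 k) ^ 2 - β k (prefixOf (genSeq β P.g0) k)
  rw [genSeq_succ]
  exact ⟨solveCoupling_pos hrhs, inv_sq_solveCoupling hrhs⟩

/-- The toy satisfies SIMULTANEOUSLY: forward generation, non-empty lattices, the sub-unit zero-step densities of §2 (b),
and the step-0 logarithm `LogNormalisedFrom … c C₀ 1` at EVERY γ — so the hypotheses of §3 are jointly satisfiable
together with those under which §2 refutes `LogNormalised`. [folklore] -/
theorem toyModel_hypotheses (β : HBeta) (c C₀ : ℝ) :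
    ForwardGenerated (toyModel β c C₀).toB12 β ∧
    (∀ P : B12.RunParams, 0 < (((toyModel β c C₀) P).numSites 0 : ℝ)) ∧
    (∀ (m : ℕ) (g0 : ℝ) (V : ((toyModel β c C₀) ⟨0, m, g0⟩).Cfg 0), ((toyModel β c C₀) ⟨0, m, g0⟩).ρ 0 V ≤ 1) ∧
    (∀ γ : ℝ, LogNormalisedFrom (toyModel β c C₀) γ c C₀ 1) := by
  refine ⟨toyModel_forwardGenerated β c C₀, fun P => ?_, fun m g0 V => ?_, fun γ P hK _ => ?_⟩
  · show (0 : ℝ) < ((1 : ℕ) : ℝ)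
    norm_num
  · show (if (0 : ℕ) = 0 then (1 : ℝ) else Real.exp (c * Real.log g0⁻¹ - C₀)) ≤ 1
    simp
  · refine ⟨(), ?_⟩
    have hK0 : P.K ≠ 0 := by omega
    show Real.exp ((c * Real.log (genSeq β P.g0 0)⁻¹ - C₀) * ((1 : ℕ) : ℝ))
      ≤ (if P.K = 0 then (1 : ℝ) else Real.exp (c * Real.log (P.g0)⁻¹ - C₀))
    rw [if_neg hK0, genSeq_zero, Nat.cast_one, mul_one]

/-- On the toy `LogNormalised` itself FAILS at every γ > 0 (c > 0), by §2 (b): the v1 pair is unsatisfiable there while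
the repaired pair holds. [folklore] -/
theorem toyModel_not_logNormalised (β : HBeta) {c : ℝ} (C₀ : ℝ) (hc : 0 < c) {γ : ℝ} (hγ : 0 < γ) :
    ¬ LogNormalised (toyModel β c C₀) γ c C₀ :=
  not_logNormalised_of_zeroStep (toyModel β c C₀) hγ hc (fun P => (toyModel_hypotheses β c C₀).1.1 P)
    (toyModel_hypotheses β c C₀).2.1 (toyModel_hypotheses β c C₀).2.2.1

/-- With the ZERO β-family (bounded above by `β′ = 0` on every box) EVERY hypothesis of the headline
`not_uvBound01_of_betaUpper` holds for the toy (c > 0) — the repaired theorem is not vacuous — and so does its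
conclusion. [folklore] -/
theorem toyModel_headline_hypotheses {c : ℝ} (C₀ : ℝ) (hc : 0 < c) :
    let β : HBeta := fun _ _ => 0
    ForwardGenerated (toyModel β c C₀).toB12 β ∧ BetaUpperH 0 1 β ∧
    (∀ P : B12.RunParams, 0 < (((toyModel β c C₀) P).numSites 0 : ℝ)) ∧
    (∀ γ : ℝ, 0 < γ → ∃ (c' C₀' : ℝ) (K₀ : ℕ), 0 < c' ∧ LogNormalisedFrom (toyModel β c C₀) γ c' C₀' K₀) ∧
    ¬ B16.UVBound01 (toyModel β c C₀) := by
  intro β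
  have h := toyModel_hypotheses β c C₀
  have hup : BetaUpperH 0 1 β := fun _ _ _ => le_rfl
  have hnorm : ∀ γ : ℝ, 0 < γ → ∃ (c' C₀' : ℝ) (K₀ : ℕ), 0 < c' ∧ LogNormalisedFrom (toyModel β c C₀) γ c' C₀' K₀ :=
    fun γ _ => ⟨c, C₀, 1, hc, h.2.2.2 γ⟩
  exact ⟨h.1, hup, h.2.1, hnorm, not_uvBound01_of_betaUpper _ h.1 one_pos le_rfl hup h.2.1 hnorm⟩

/-! ## §5. Sharpenings (v1.1, append-only): one γ suffices; the K₀ = 1 logarithm from the located leaves of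
`B16B10Shape` §4; the refutation of (B) with every input located -/

/-- `LogNormalisedFrom` is ANTITONE in γ: the logarithm asked of the ]0, γ′]-family (γ ≤ γ′) covers the ]0, γ]-family
(`Flow.InInterval` is monotone in γ). [folklore] -/
theorem logNormalisedFrom_anti_gamma (C : B16.Construction) {γ γ' : ℝ} (h : γ ≤ γ') {c C₀ : ℝ} {K₀ : ℕ}
    (hn : LogNormalisedFrom C γ' c C₀ K₀) : LogNormalisedFrom C γ c C₀ K₀ :=
  fun P hK hI => hn P hK fun k hk => ⟨(hI k hk).1, (hI k hk).2.trans h⟩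

/-- `B16.UV01With` is ANTITONE in γ ((0.1) asked of the ]0, γ′]-family covers the ]0, γ]-family, γ ≤ γ′). [folklore] -/
theorem uv01With_anti_gamma (C : B16.Construction) {γ γ' Em Ep : ℝ} (h : γ ≤ γ')
    (hu : B16.UV01With C γ' Em Ep) : B16.UV01With C γ Em Ep :=
  fun P hI k hk V => hu P (fun j hj => ⟨(hI j hj).1, (hI j hj).2.trans h⟩) k hk V

/-- **ONE γ SUFFICES.**  The step-0 logarithm on the ]0, γ₁]-family from length `K₀` on (one `γ₁ > 0`, `c > 0`) and
small bare couplings from length `K₀` on in every ]0, γ]-family with `γ ≤ γ₁` exclude the constant-exponent reading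
`B16.UVBound01 C`: a witness `γ, E₋, E₊` of (B) restricts to `min γ γ₁` (both sides antitone). [folklore] -/
theorem not_uvBound01_of_smallCouplingsFrom_at (C : B16.Construction) {γ₁ c C₀ : ℝ} {K₀ : ℕ} (hγ₁ : 0 < γ₁)
    (hc : 0 < c) (hnorm : LogNormalisedFrom C γ₁ c C₀ K₀)
    (hsmall : ∀ γ : ℝ, 0 < γ → γ ≤ γ₁ → SmallCouplingsOccurFrom C γ K₀) : ¬ B16.UVBound01 C := by
  rintro ⟨γ, hγ, Em, Ep, h⟩
  exact not_uv01With_of_smallCouplingsFrom C (min γ γ₁) c C₀ Em Ep K₀ hc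
    (logNormalisedFrom_anti_gamma C (min_le_right _ _) hnorm) (hsmall _ (lt_min hγ hγ₁) (min_le_right _ _))
    (uv01With_anti_gamma C (min_le_left _ _) h)

/-- **HEADLINE, one-γ form.**  For a forward-generated `B16.Construction` with β bounded above on some box family and
non-empty lattices, the step-0 logarithm on ONE ]0, γ₁]-family (γ₁ > 0, c > 0, from some length K₀ on) excludes the
constant-exponent reading (B) `B16.UVBound01 C`. [folklore] -/
theorem not_uvBound01_of_betaUpper_at (C : B16.Construction) {β : HBeta} (hgen : ForwardGenerated C.toB12 β)
    {γ₀ β' : ℝ} (hγ₀ : 0 < γ₀) (hβ' : 0 ≤ β') (hup : BetaUpperH β' γ₀ β)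
    (hN : ∀ P : B12.RunParams, 0 < ((C P).numSites 0 : ℝ)) {γ₁ c C₀ : ℝ} {K₀ : ℕ} (hγ₁ : 0 < γ₁)
    (hc : 0 < c) (hnorm : LogNormalisedFrom C γ₁ c C₀ K₀) : ¬ B16.UVBound01 C :=
  not_uvBound01_of_smallCouplingsFrom_at C hγ₁ hc hnorm
    fun _ hγ _ => smallCouplingsOccurFrom_of_betaUpper C hgen hγ₀ hβ' hup hN hγ K₀

/-- **The K₀ = 1 logarithm FROM THE LOCATED LEAVES of `B16B10Shape` §4.**  A family `S P` of per-run carriers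
(`B16B10Shape.CountertermData`) over the run parameters, with the constants `L ≥ 2`, `d(𝔤)`, `log σ₀`, `C_z`, `C_E`
UNIFORM in the run, the dictionary `K`, `|T₁^{(0)}|`, `g_j` ↔ the run, the located leaves (1.15) / E = Σ / blocking
and the labelled reader's items `TstarCount` (PROVED in dictionary form, `B16TstarCount`), `ZLower` (PROVED for U(N),
SU(N), `B16ZLower`), `EflBound` (OPEN, author question (ii) of cell GAPS G-pv24-1) — the last three and the normalisation
`ρ₀ ≥ e^{−E}` at some configuration ([III] Thm 1 p. 262) asked only of the runs of the ]0, γ]-family with at least one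
step — GIVES `LogNormalisedFrom C γ (3(1 − L⁻⁴)d(𝔤)) (4|log σ₀| + C_z + C_E/(L⁴ − 1)) 1` for `γ ≤ 1` (run by run
`B16B10Shape.unitConfigLog_of_leaves`, whose hypothesis `1 ≤ S.K` is exactly the cut K₀ = 1; the couplings-in-]0, 1]
leaf is read off `Flow.InInterval γ` with γ ≤ 1).  Every leaf a hypothesis; nothing of the series asserted. [cite: Balaban1988Convergent, Thm 1 p.262 and (1.15) p.249] -/
theorem logNormalisedFrom_one_of_leaves (C : B16.Construction) {γ : ℝ} (hγ1 : γ ≤ 1)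
    (S : B12.RunParams → CountertermData) (L dg : ℕ) (logσ₀ Cz CE : ℝ)
    (hL : ∀ P, (S P).L = L) (hdg : ∀ P, (S P).dg = dg) (hσ : ∀ P, (S P).logσ₀ = logσ₀)
    (hK : ∀ P, (S P).K = P.K) (hN0 : ∀ P, (S P).N 0 = ((C P).numSites 0 : ℝ))
    (hgd : ∀ P j, j ≤ P.K → (S P).g j = (C P).flow.g j)
    (h115 : ∀ P, (S P).OneStep115) (hsum : ∀ P, (S P).ESum) (hT : ∀ P, (S P).TstarCount)
    (hB : ∀ P, (S P).Blocking) (hN : ∀ P j, 0 ≤ (S P).N j)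
    (hρ : ∀ P, 1 ≤ P.K → (C P).flow.InInterval γ P.K →
      ∃ V₁ : (C P).Cfg 0, Real.exp (-(S P).E) ≤ (C P).ρ 0 V₁)
    (hz : ∀ P, 1 ≤ P.K → (C P).flow.InInterval γ P.K → (S P).ZLower Cz)
    (hE : ∀ P, 1 ≤ P.K → (C P).flow.InInterval γ P.K → (S P).EflBound CE)
    (h2L : 2 ≤ L) (hCz : 0 ≤ 4 * |logσ₀| + Cz) (hCE : 0 ≤ CE) :
    LogNormalisedFrom C γ (3 * (1 - 1 / (L : ℝ) ^ 4) * dg) (4 * |logσ₀| + Cz + CE / (((L : ℝ) ^ 4) - 1)) 1 := by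
  intro P hKP hI
  have hg : (S P).SmallCouplings := fun j hj => by
    have hj' : j ≤ P.K := by rw [← hK P]; exact hj.le
    rw [hgd P j hj']
    exact ⟨(hI j hj').1, (hI j hj').2.trans hγ1⟩
  have h := unitConfigLog_of_leaves (C P) (S P) Cz CE (hN0 P) (hgd P 0 (Nat.zero_le _)) (hρ P hKP hI)
    (h115 P) (hsum P) (hT P) (hB P) (hz P hKP hI) (hE P hKP hI) hg (by rw [hL P]; exact h2L) (hN P)
    (by rw [hK P]; exact hKP) (by rw [hσ P]; exact hCz) hCE
  rw [hL P, hdg P, hσ P] at h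
  exact h

/-- The slope `3(1 − L⁻⁴)d(𝔤)` of the leaves' logarithm is positive for `L ≥ 2`, `d(𝔤) ≥ 1`. Real arithmetic. [folklore] -/
theorem leaves_slope_pos {L dg : ℕ} (h2L : 2 ≤ L) (hdg : 1 ≤ dg) : 0 < 3 * (1 - 1 / (L : ℝ) ^ 4) * dg := by
  have hL' : (2 : ℝ) ≤ (L : ℝ) := by exact_mod_cast h2L
  have hL4 : (16 : ℝ) ≤ (L : ℝ) ^ 4 := by
    have h := pow_le_pow_left₀ (by norm_num : (0 : ℝ) ≤ 2) hL' 4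
    norm_num at h
    exact h
  have h1 : 1 / (L : ℝ) ^ 4 ≤ 1 / 16 := one_div_le_one_div_of_le (by norm_num) hL4
  have h2 : (0 : ℝ) < 1 - 1 / (L : ℝ) ^ 4 := by linarith
  have hdg' : (0 : ℝ) < dg := by exact_mod_cast Nat.lt_of_lt_of_le Nat.zero_lt_one hdg
  exact mul_pos (mul_pos (by norm_num) h2) hdg'

/-- **(B) REFUTED WITH EVERY INPUT LOCATED.**  For a forward-generated `B16.Construction` ([I] (0.17)–(0.20)) whose
history β-family is bounded above on some box family ([I] p. 264 "uniformly bounded"; `FlowStep.BetaUpperH`), with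
non-empty lattices and `d(𝔤) ≥ 1`, a leaf family as in `logNormalisedFrom_one_of_leaves` on the runs of ONE
]0, γ₁]-family (0 < γ₁ ≤ 1) with at least one step EXCLUDES the constant-exponent reading (B) `B16.UVBound01 C` of
(0.1).  Inputs: located leaves ((1.15), E = Σ, blocking, ρ₀ ≥ e^{−E}), the labelled reader's items (`TstarCount`,
`ZLower` — both proved in siblings in dictionary form —, `EflBound` — OPEN), the dictionary, and the cell's modelling
clauses; NO free-standing normalisation hypothesis (v1 `LogNormalised` / B16B10Shape §3) remains.  Bookkeeping;
nothing printed asserted; NOT a claim about Bałaban's densities until the leaves are instantiated. [folklore] -/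
theorem not_uvBound01_of_leaves (C : B16.Construction) {β : HBeta} (hgen : ForwardGenerated C.toB12 β)
    {γ₀ β' : ℝ} (hγ₀ : 0 < γ₀) (hβ' : 0 ≤ β') (hup : BetaUpperH β' γ₀ β)
    (hNpos : ∀ P : B12.RunParams, 0 < ((C P).numSites 0 : ℝ)) {γ₁ : ℝ} (hγ₁ : 0 < γ₁) (hγ1 : γ₁ ≤ 1)
    (S : B12.RunParams → CountertermData) (L dg : ℕ) (logσ₀ Cz CE : ℝ)
    (hL : ∀ P, (S P).L = L) (hdg : ∀ P, (S P).dg = dg) (hσ : ∀ P, (S P).logσ₀ = logσ₀)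
    (hK : ∀ P, (S P).K = P.K) (hN0 : ∀ P, (S P).N 0 = ((C P).numSites 0 : ℝ))
    (hgd : ∀ P j, j ≤ P.K → (S P).g j = (C P).flow.g j)
    (h115 : ∀ P, (S P).OneStep115) (hsum : ∀ P, (S P).ESum) (hT : ∀ P, (S P).TstarCount)
    (hB : ∀ P, (S P).Blocking) (hN : ∀ P j, 0 ≤ (S P).N j)
    (hρ : ∀ P, 1 ≤ P.K → (C P).flow.InInterval γ₁ P.K →
      ∃ V₁ : (C P).Cfg 0, Real.exp (-(S P).E) ≤ (C P).ρ 0 V₁)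
    (hz : ∀ P, 1 ≤ P.K → (C P).flow.InInterval γ₁ P.K → (S P).ZLower Cz)
    (hE : ∀ P, 1 ≤ P.K → (C P).flow.InInterval γ₁ P.K → (S P).EflBound CE)
    (h2L : 2 ≤ L) (hdg1 : 1 ≤ dg) (hCz : 0 ≤ 4 * |logσ₀| + Cz) (hCE : 0 ≤ CE) : ¬ B16.UVBound01 C :=
  not_uvBound01_of_betaUpper_at C hgen hγ₀ hβ' hup hNpos hγ₁ (leaves_slope_pos h2L hdg1)
    (logNormalisedFrom_one_of_leaves C hγ1 S L dg logσ₀ Cz CE hL hdg hσ hK hN0 hgd h115 hsum hT hB hN hρ hz hE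
      h2L hCz hCE)

end B16SmallCouplings

end Literature.MathematicalPhysics.QuantumFieldTheory.Balaban1983to89
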